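import Literature.Probability.FitznerVanDerHofstad2017.NbwRemainderRig
import Literature.Probability.FitznerVanDerHofstad2017.NobleImprovementInputsRem
import HarnessLib

/-!
# A kernel-checkable certificate format for tables of remainder constants (`RemValid`)

`NobleImprovementInputsRem.RemValid d CS R` asks that, for every read `r` of the re-cut oracle and every
admissible composition `c` of the read (`RemRead.comps`: `n_r` positive parts summing to `M_r`), the number
`R r` be a valid remainder-kernel constant (`IsRemKernelConst d c (r.pts d) (R r)`:
`Rem_c(p;x) ≤ Γ̄₂(p)ⁿ · R r`, [NoBLE] §5.3.2 first display).  `NbwRemainderRig` and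
`NbwOddMultiplierBound` give, for every composition, a CLOSED-FORM valid constant: a finite sum
`Σ_j q_j (2d)^j I_{n,j}(0)` over the coefficients `q_j` of a product of NBW polynomials (times a fixed
multiplier), plus a bulk term `κ · ∏ᵢ B(cᵢ) · I_{n,0}(0)` — all in terms of the SRW integrals
`I_{n,l}(0) = srwI d n l 0` of [NoBLE] (5.1).

This module turns "`R` dominates every closed form" into ONE decidable check, so that a concrete table can be
certified by `decide` (kernel evaluation, no floating point):

* `coefL … nbwL`: exact `ℚ`-coefficient-list arithmetic reproducing the NBW polynomials
  (`polyOfList (nbwL d m) = nbwPoly d m`);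
* `sumUp`, `bulkQ`, `rigUp`, `rigSingleUp`, `oddMulUp`: rational UPPER envelopes of the three closed forms
  over abstract two-sided tables `lo n l ≤ I_{n,l}(0) ≤ hi n l` (sign-split endpoints; bulk constants through
  `nbwBulkBound_le_of_sqrt_le` at a rational `s ≥ √(2d-1)`);
* `compsL`, `allSorted`: the admissible compositions enumerated, each multiset checked once (sorted
  representative — the closed forms are symmetric in the parts);
* `remValid_of_checks`: the soundness theorem — table enclosures + `s ≥ √(2d-1)` + the odd-multiplier
  licence + the Boolean checks ⟹ `RemValid d CS R`.

Everything here is `d`-generic and numeral-free; an instance supplies the tables, `s`, the multiplier and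
`R` and discharges the checks by `decide`.  This is arithmetic bookkeeping around the printed display
[NoBLE] §5.3.2 (which is cited on the one theorem that produces `RemValid`); no claim of print is restated.
-/

namespace Literature.Probability.FitznerVanDerHofstad2017

open Polynomial

namespace RemCert


/-! ### ℚ-coefficient-list polynomials (index = power) -/

/-- Coefficient `j` of the list polynomial `l` (`0` beyond the end). [folklore] -/
def coefL : List ℚ → ℕ → ℚ
  | [], _ => 0
  | a :: _, 0 => a
  | _ :: l, j + 1 => coefL l j

/-- Termwise sum of two coefficient lists (keeps the longer tail). [folklore] -/
def addL : List ℚ → List ℚ → List ℚ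
  | [], l => l
  | a :: l, [] => a :: l
  | a :: l, b :: m => (a + b) :: addL l m

/-- Scalar multiple of a coefficient list. [folklore] -/
def smulL (a : ℚ) (l : List ℚ) : List ℚ := l.map (a * ·)

/-- Product of two coefficient lists (convolution): `(a :: l) * m = a • m + X · (l * m)`. [folklore] -/
def mulL : List ℚ → List ℚ → List ℚ
  | [], _ => []
  | a :: l, m => addL (smulL a m) (0 :: mulL l m)

/-- Product of a list of coefficient lists (`[1]` for the empty product). [folklore] -/
def prodL : List (List ℚ) → List ℚ
  | [] => [1]
  | l :: ls => mulL l (prodL ls)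

/-- Coefficient lists of the NBW polynomials `P_m` (`NbwLawFourier.nbwPoly`): `P_0 = 1`, `P_1 = A`,
`P_2 = A² - 2d`, `P_{m+3} = A·P_{m+2} - (2d-1)·P_{m+1}`. [folklore] -/
def nbwL (d : ℕ) : ℕ → List ℚ
  | 0 => [1]
  | 1 => [0, 1]
  | 2 => [-(2 * (d : ℚ)), 0, 1]
  | m + 3 => addL (0 :: nbwL d (m + 2)) (smulL (-(2 * (d : ℚ) - 1)) (nbwL d (m + 1)))

/-! ### Interval evaluation of the closed forms over abstract endpoint tables `lo n l ≤ I_{n,l}(0) ≤ hi n l` -/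

/-- Sign-split table endpoint: `hi n j` for a coefficient `q ≥ 0`, `lo n j` for `q < 0`. [folklore] -/
def bnd (lo hi : ℕ → ℕ → ℚ) (n j : ℕ) (q : ℚ) : ℚ := if 0 ≤ q then hi n j else lo n j

/-- `sumUp lo hi n a l j₀ = Σ_i l_i · a^{j₀+i} · bnd(n, j₀+i, l_i)` — an upper bound of `Σ_i l_i a^{j₀+i} I_{n,j₀+i}(0)`. [folklore] -/
def sumUp (lo hi : ℕ → ℕ → ℚ) (n : ℕ) (a : ℚ) : List ℚ → ℕ → ℚ
  | [], _ => 0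
  | q :: l, j => q * a ^ j * bnd lo hi n j q + sumUp lo hi n a l (j + 1)

/-- Rational envelope of the bulk constant `B(m) ≤ s^m (m+1) + s^{m-2} (m-1)` for `s ≥ √(2d-1)`
(`nbwBulkBound_le_of_sqrt_le`). [folklore] -/
def bulkQ (s : ℚ) (m : ℕ) : ℚ := s ^ m * ((m : ℚ) + 1) + s ^ (m - 2) * ((m - 1 : ℕ) : ℚ)

/-- `∏ᵢ bulkQ s cᵢ`. [folklore] -/
def bulkProdQ (s : ℚ) : List ℕ → ℚ
  | [] => 1
  | m :: c => bulkQ s m * bulkProdQ s c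

/-- Upper bound of the x-uniform RIG closed form (even compositions):
`Σ_j [∏P]_j (2d)^j I_{n,j}(0) + 2 (∏B) I_{n,0}(0)`, `n = |c|`. [folklore] -/
def rigUp (d : ℕ) (lo hi : ℕ → ℕ → ℚ) (s : ℚ) (c : List ℕ) : ℚ :=
  sumUp lo hi c.length (2 * (d : ℚ)) (prodL (c.map (nbwL d))) 0 + 2 * bulkProdQ s c * hi c.length 0

/-- Upper bound of the `e₁`-kernel RIG closed form (odd compositions): polynomial `(∏P)·X/(2d)`, bulk
`2 (∏B · √(2d-1)/d) I_{n,0}(0)`. [folklore] -/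
def rigSingleUp (d : ℕ) (lo hi : ℕ → ℕ → ℚ) (s : ℚ) (c : List ℕ) : ℚ :=
  sumUp lo hi c.length (2 * (d : ℚ)) (0 :: smulL (1 / (2 * (d : ℚ))) (prodL (c.map (nbwL d)))) 0
    + 2 * (bulkProdQ s c * (s / (d : ℚ))) * hi c.length 0

/-- Upper bound of the odd-multiplier closed form (odd compositions, multiplier coefficient list `g`,
bulk constant `H`): polynomial `(∏P)·g`, bulk `(1+H) (∏B) I_{n,0}(0)`. [folklore] -/
def oddMulUp (d : ℕ) (lo hi : ℕ → ℕ → ℚ) (s : ℚ) (g : List ℚ) (H : ℚ) (c : List ℕ) : ℚ :=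
  sumUp lo hi c.length (2 * (d : ℚ)) (mulL (prodL (c.map (nbwL d))) g) 0
    + (1 + H) * bulkProdQ s c * hi c.length 0

/-- The three per-composition CHECKS (degree within the table range `L`, `0 ≤ lo n 0`, bound `≤ R`). [folklore] -/
def rigCheck (d L : ℕ) (lo hi : ℕ → ℕ → ℚ) (s R : ℚ) (c : List ℕ) : Bool :=
  decide ((prodL (c.map (nbwL d))).length ≤ L + 1) && decide (0 ≤ lo c.length 0)
    && decide (rigUp d lo hi s c ≤ R)

/-- See `rigCheck`. [folklore] -/
def rigSingleCheck (d L : ℕ) (lo hi : ℕ → ℕ → ℚ) (s R : ℚ) (c : List ℕ) : Bool :=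
  decide ((prodL (c.map (nbwL d))).length + 1 ≤ L + 1) && decide (0 ≤ lo c.length 0)
    && decide (rigSingleUp d lo hi s c ≤ R)

/-- See `rigCheck`. [folklore] -/
def oddMulCheck (d L : ℕ) (lo hi : ℕ → ℕ → ℚ) (s : ℚ) (g : List ℚ) (H R : ℚ) (c : List ℕ) : Bool :=
  decide ((mulL (prodL (c.map (nbwL d))) g).length ≤ L + 1) && decide (0 ≤ lo c.length 0)
    && decide (0 ≤ 1 + H) && decide (oddMulUp d lo hi s g H c ≤ R)

/-! ### The admissible compositions of a read, enumerated -/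

/-- All lists of `n` POSITIVE naturals with sum `M` (= `RemRead.comps`, rule 'all'). [folklore] -/
def compsL : ℕ → ℕ → List (List ℕ)
  | 0, M => if M = 0 then [[]] else []
  | n + 1, M => (List.range' 1 M).flatMap fun m => (compsL n (M - m)).map (m :: ·)


/-- Check `chk` on every SORTED (non-decreasing) admissible composition with `n` parts and sum `M`; the closed
forms are symmetric in the parts, so one representative per multiset suffices (`remValid_of_checks`).
[folklore] -/
def allSorted (n M : ℕ) (chk : List ℕ → Bool) : Bool :=
  (compsL n M).all fun c => !(decide (List.Pairwise (· ≤ ·) c)) || chk c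

/-! ### Semantics of the coefficient lists -/

/-- The real polynomial with coefficient list `l`: `polyOfList (a :: l) = C a + X · polyOfList l`. [folklore] -/
noncomputable def polyOfList : List ℚ → ℝ[X]
  | [] => 0
  | a :: l => C ((a : ℚ) : ℝ) + X * polyOfList l

/-- The odd-multiplier closed form of `NbwOddMultiplierBound.isRemKernelConst_oddMul` for a multiplier
polynomial `g` and bulk constant `H`: `Σ_j [(∏P)·g]_j (2d)^j I_{n,j}(0) + (1+H) (∏B) I_{n,0}(0)`. [folklore] -/
noncomputable def oddForm (d : ℕ) (g : ℝ[X]) (H : ℝ) (c : List ℕ) : ℝ :=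
  (∑ j ∈ Finset.range (((c.map (nbwPoly d)).prod * g).natDegree + 1),
      ((c.map (nbwPoly d)).prod * g).coeff j * (2 * (d : ℝ)) ^ j * srwI d c.length j 0)
    + ((1 + H) * (c.map (nbwBulkBound d)).prod) * srwI d c.length 0 0

/-- The coefficients of `polyOfList l` are the casts of `coefL l`. [folklore] -/
private theorem coeff_polyOfList : ∀ (l : List ℚ) (j : ℕ), (polyOfList l).coeff j = ((coefL l j : ℚ) : ℝ)
  | [], j => by simp [polyOfList, coefL]
  | a :: l, 0 => by simp [polyOfList, coefL]
  | a :: l, j + 1 => by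
      rw [polyOfList, coeff_add, coeff_C_succ, coeff_X_mul, zero_add, coeff_polyOfList l j]
      simp [coefL]

/-- `coefL l j = 0` beyond the end of the list. [folklore] -/
private theorem coefL_eq_zero : ∀ (l : List ℚ) (j : ℕ), l.length ≤ j → coefL l j = 0
  | [], _, _ => rfl
  | _ :: _, 0, h => by simp at h
  | _ :: l, j + 1, h => coefL_eq_zero l j (by simpa using h)

/-- `polyOfList (0 :: l) = X · polyOfList l`. [folklore] -/
private theorem polyOfList_cons_zero (l : List ℚ) : polyOfList (0 :: l) = X * polyOfList l := by
  simp [polyOfList]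

/-- `addL` is addition of polynomials. [folklore] -/
private theorem polyOfList_addL : ∀ l m, polyOfList (addL l m) = polyOfList l + polyOfList m
  | [], m => by simp [addL, polyOfList]
  | a :: l, [] => by simp [addL, polyOfList]
  | a :: l, b :: m => by
      simp only [addL, polyOfList, polyOfList_addL l m, Rat.cast_add, C_add]; ring

/-- `smulL a` is multiplication by the constant `a`. [folklore] -/
private theorem polyOfList_smulL (a : ℚ) : ∀ l, polyOfList (smulL a l) = C ((a : ℚ) : ℝ) * polyOfList l
  | [] => by simp [smulL, polyOfList]
  | b :: l => by
      have ih := polyOfList_smulL a l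
      simp only [smulL, List.map_cons, polyOfList] at ih ⊢
      rw [ih, Rat.cast_mul, C_mul]; ring

/-- `mulL` is multiplication of polynomials. [folklore] -/
private theorem polyOfList_mulL : ∀ l m, polyOfList (mulL l m) = polyOfList l * polyOfList m
  | [], m => by simp [mulL, polyOfList]
  | a :: l, m => by
      rw [mulL, polyOfList_addL, polyOfList_smulL, polyOfList_cons_zero, polyOfList_mulL l m, polyOfList]
      ring

/-- `prodL` is the product of polynomials. [folklore] -/
private theorem polyOfList_prodL : ∀ ls, polyOfList (prodL ls) = (ls.map polyOfList).prod
  | [] => by simp [prodL, polyOfList]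
  | l :: ls => by simp [prodL, polyOfList_mulL, polyOfList_prodL ls]

/-- `nbwL d m` is the coefficient list of the NBW polynomial `nbwPoly d m`. [folklore] -/
private theorem polyOfList_nbwL (d : ℕ) : ∀ m, polyOfList (nbwL d m) = nbwPoly d m
  | 0 => by simp [nbwL, polyOfList]
  | 1 => by simp [nbwL, polyOfList]
  | 2 => by
      simp only [nbwL, polyOfList, nbwPoly_two, Rat.cast_neg, Rat.cast_mul, Rat.cast_natCast,
        Rat.cast_ofNat, Rat.cast_zero, Rat.cast_one, map_neg, C_0, C_1]
      ring
  | m + 3 => by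
      rw [nbwL, polyOfList_addL, polyOfList_cons_zero, polyOfList_smulL, polyOfList_nbwL d (m + 2),
        polyOfList_nbwL d (m + 1), nbwPoly_add_three]
      have : C (((-(2 * (d : ℚ) - 1) : ℚ) : ℝ)) = -C (2 * (d : ℝ) - 1) := by
        rw [← map_neg]; congr 1; push_cast; ring
      rw [this]; ring

/-- `prodL (c.map (nbwL d))` is the coefficient list of `∏ᵢ P_{cᵢ}`. [folklore] -/
private theorem polyOfList_prodL_nbwL (d : ℕ) (c : List ℕ) :
    polyOfList (prodL (c.map (nbwL d))) = (c.map (nbwPoly d)).prod := by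
  rw [polyOfList_prodL, List.map_map]
  exact congrArg List.prod (List.map_congr_left fun m _ => polyOfList_nbwL d m)

/-! ### Soundness of the interval evaluation -/

/-- A coefficient sum over `range (natDegree + 1)` equals the same sum over `range l.length`. [folklore] -/
private theorem sum_range_natDegree_eq (l : List ℚ) (g : ℕ → ℝ) :
    ∑ j ∈ Finset.range ((polyOfList l).natDegree + 1), (polyOfList l).coeff j * g j =
      ∑ j ∈ Finset.range l.length, ((coefL l j : ℚ) : ℝ) * g j := by
  simp_rw [coeff_polyOfList]
  rcases le_total ((polyOfList l).natDegree + 1) l.length with h | h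
  · apply Finset.sum_subset (Finset.range_mono h)
    intro j hj hj'
    simp only [Finset.mem_range, not_lt] at hj hj'
    have h0 : (polyOfList l).coeff j = 0 :=
      coeff_eq_zero_of_natDegree_lt (by omega)
    rw [coeff_polyOfList] at h0
    rw [h0, zero_mul]
  · symm
    apply Finset.sum_subset (Finset.range_mono h)
    intro j hj hj'
    simp only [Finset.mem_range, not_lt] at hj hj'
    rw [coefL_eq_zero l j hj', Rat.cast_zero, zero_mul]

/-- One term: `q · A · f ≤ q · A · bnd(q)` when `lo ≤ f ≤ hi` and `A ≥ 0` (sign split on `q`). [folklore] -/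
private theorem term_le_bnd (lo hi : ℕ → ℕ → ℚ) {n j : ℕ} {f : ℝ} (hlo : ((lo n j : ℚ) : ℝ) ≤ f)
    (hhi : f ≤ ((hi n j : ℚ) : ℝ)) (q : ℚ) {A : ℝ} (hA : 0 ≤ A) :
    (q : ℝ) * A * f ≤ (q : ℝ) * A * ((bnd lo hi n j q : ℚ) : ℝ) := by
  unfold bnd
  split_ifs with hq
  · exact mul_le_mul_of_nonneg_left hhi (mul_nonneg (by exact_mod_cast hq) hA)
  · have hqA : (q : ℝ) * A ≤ 0 :=
      mul_nonpos_iff.2 (Or.inr ⟨by exact_mod_cast (not_le.1 hq).le, hA⟩)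
    exact mul_le_mul_of_nonpos_left hlo hqA

/-- `sumUp` dominates the coefficient sum termwise (induction on the list, shifting the start index). [folklore] -/
private theorem sum_le_sumUp {lo hi : ℕ → ℕ → ℚ} {n L : ℕ} {f : ℕ → ℝ}
    (henc : ∀ j ≤ L, ((lo n j : ℚ) : ℝ) ≤ f j ∧ f j ≤ ((hi n j : ℚ) : ℝ)) (a : ℚ) (ha : 0 ≤ a) :
    ∀ (l : List ℚ) (j₀ : ℕ), j₀ + l.length ≤ L + 1 →
      ∑ i ∈ Finset.range l.length, ((coefL l i : ℚ) : ℝ) * (a : ℝ) ^ (j₀ + i) * f (j₀ + i)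
        ≤ ((sumUp lo hi n a l j₀ : ℚ) : ℝ)
  | [], j₀, _ => by simp [sumUp]
  | q :: l, j₀, h => by
      rw [List.length_cons] at h
      rw [List.length_cons, Finset.sum_range_succ', sumUp]
      have ih := sum_le_sumUp henc a ha l (j₀ + 1) (by omega)
      have hj₀ : j₀ ≤ L := by omega
      have ht := term_le_bnd lo hi (henc j₀ hj₀).1 (henc j₀ hj₀).2 q
        (pow_nonneg (show (0 : ℝ) ≤ (a : ℝ) by exact_mod_cast ha) j₀)
      have hih : ∑ i ∈ Finset.range l.length,
          ((coefL l i : ℚ) : ℝ) * (a : ℝ) ^ (j₀ + (i + 1)) * f (j₀ + (i + 1))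
          ≤ ((sumUp lo hi n a l (j₀ + 1) : ℚ) : ℝ) := by
        refine le_of_eq_of_le (Finset.sum_congr rfl fun i _ => ?_) ih
        rw [show j₀ + (i + 1) = j₀ + 1 + i by omega]
      simp only [coefL, Nat.add_zero]
      push_cast
      linarith

/-- `Σ_j [polyOfList l]_j (2d)^j I_{n,j}(0) ≤ sumUp lo hi n (2d) l 0` under the table enclosures. [folklore] -/
private theorem polySum_le_sumUp {d n L : ℕ} {lo hi : ℕ → ℕ → ℚ}
    (henc : ∀ j ≤ L, ((lo n j : ℚ) : ℝ) ≤ srwI d n j 0 ∧ srwI d n j 0 ≤ ((hi n j : ℚ) : ℝ))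
    (l : List ℚ) (hl : l.length ≤ L + 1) :
    ∑ j ∈ Finset.range ((polyOfList l).natDegree + 1),
        (polyOfList l).coeff j * (2 * (d : ℝ)) ^ j * srwI d n j 0
      ≤ ((sumUp lo hi n (2 * (d : ℚ)) l 0 : ℚ) : ℝ) := by
  have h1 := sum_range_natDegree_eq l (fun j => (2 * (d : ℝ)) ^ j * srwI d n j 0)
  simp only [← mul_assoc] at h1
  rw [h1]
  have h2 := sum_le_sumUp (f := fun j => srwI d n j 0) henc (2 * (d : ℚ)) (by positivity) l 0
    (by simpa using hl)
  simpa using h2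

/-- The cast of `bulkProdQ s c` is the product of the real envelopes `s^m (m+1) + s^{m-2} (m-1)`. [folklore] -/
private theorem cast_bulkProdQ (s : ℚ) : ∀ c : List ℕ, ((bulkProdQ s c : ℚ) : ℝ) =
    (c.map fun m : ℕ => (s : ℝ) ^ m * ((m : ℝ) + 1) + (s : ℝ) ^ (m - 2) * ((m - 1 : ℕ) : ℝ)).prod
  | [] => by simp [bulkProdQ]
  | m :: c => by
      rw [bulkProdQ, Rat.cast_mul, cast_bulkProdQ s c, List.map_cons, List.prod_cons, bulkQ]
      push_cast; ring

/-- `0 ≤ ∏ᵢ B(cᵢ)`. [folklore] -/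
private theorem prod_nbwBulkBound_nonneg (d : ℕ) (c : List ℕ) : 0 ≤ (c.map (nbwBulkBound d)).prod :=
  List.prod_nonneg fun x hx => by
    obtain ⟨i, -, rfl⟩ := List.mem_map.1 hx; exact nbwBulkBound_nonneg d i

/-- `∏ᵢ B(cᵢ) ≤ bulkProdQ s c` for `s ≥ √(2d-1)` (`prod_nbwBulkBound_le_of_sqrt_le`). [folklore] -/
private theorem prod_nbwBulkBound_le_bulkProdQ {d : ℕ} {s : ℚ} (hs : √(2 * (d : ℝ) - 1) ≤ (s : ℝ))
    (c : List ℕ) : (c.map (nbwBulkBound d)).prod ≤ ((bulkProdQ s c : ℚ) : ℝ) := by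
  rw [cast_bulkProdQ]; exact prod_nbwBulkBound_le_of_sqrt_le hs c

/-- Soundness of `rigCheck`: the x-uniform RIG closed form is `≤ R`. [folklore] -/
private theorem rig_le_of_check {d L : ℕ} {lo hi : ℕ → ℕ → ℚ} {c : List ℕ}
    (henc : ∀ j ≤ L, ((lo c.length j : ℚ) : ℝ) ≤ srwI d c.length j 0 ∧
      srwI d c.length j 0 ≤ ((hi c.length j : ℚ) : ℝ))
    {s : ℚ} (hs : √(2 * (d : ℝ) - 1) ≤ (s : ℝ)) {R : ℚ} (h : rigCheck d L lo hi s R c = true) :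
    (∑ j ∈ Finset.range (((c.map (nbwPoly d)).prod).natDegree + 1),
        ((c.map (nbwPoly d)).prod).coeff j * (2 * (d : ℝ)) ^ j * srwI d c.length j 0)
      + 2 * (c.map (nbwBulkBound d)).prod * srwI d c.length 0 0 ≤ ((R : ℚ) : ℝ) := by
  simp only [rigCheck, Bool.and_eq_true, decide_eq_true_eq] at h
  obtain ⟨⟨hlen, hlo0⟩, hle⟩ := h
  have hmain := polySum_le_sumUp henc (prodL (c.map (nbwL d))) hlen
  rw [polyOfList_prodL_nbwL] at hmain
  have hI0 : 0 ≤ srwI d c.length 0 0 :=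
    le_trans (by exact_mod_cast hlo0) (henc 0 (Nat.zero_le _)).1
  have hIhi : srwI d c.length 0 0 ≤ ((hi c.length 0 : ℚ) : ℝ) := (henc 0 (Nat.zero_le _)).2
  have hB := prod_nbwBulkBound_le_bulkProdQ hs c
  have hB0 := prod_nbwBulkBound_nonneg d c
  have hbulk : (c.map (nbwBulkBound d)).prod * srwI d c.length 0 0
      ≤ ((bulkProdQ s c : ℚ) : ℝ) * ((hi c.length 0 : ℚ) : ℝ) :=
    mul_le_mul hB hIhi hI0 (hB0.trans hB)
  have hle' : ((rigUp d lo hi s c : ℚ) : ℝ) ≤ ((R : ℚ) : ℝ) := by exact_mod_cast hle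
  have hR : ((rigUp d lo hi s c : ℚ) : ℝ) = ((sumUp lo hi c.length (2 * (d : ℚ))
      (prodL (c.map (nbwL d))) 0 : ℚ) : ℝ) + 2 * ((bulkProdQ s c : ℚ) : ℝ) * ((hi c.length 0 : ℚ) : ℝ) := by
    simp only [rigUp]; push_cast; ring
  linarith

/-- Soundness of `rigSingleCheck`: the `e₁`-kernel RIG closed form is `≤ R`. [folklore] -/
private theorem rigSingle_le_of_check {d L : ℕ} {lo hi : ℕ → ℕ → ℚ} {c : List ℕ}
    (henc : ∀ j ≤ L, ((lo c.length j : ℚ) : ℝ) ≤ srwI d c.length j 0 ∧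
      srwI d c.length j 0 ≤ ((hi c.length j : ℚ) : ℝ))
    {s : ℚ} (hs : √(2 * (d : ℝ) - 1) ≤ (s : ℝ)) (hd : 1 ≤ d) {R : ℚ}
    (h : rigSingleCheck d L lo hi s R c = true) :
    (∑ j ∈ Finset.range ((((c.map (nbwPoly d)).prod * C (1 / (2 * (d : ℝ))) * X)).natDegree + 1),
        (((c.map (nbwPoly d)).prod * C (1 / (2 * (d : ℝ))) * X)).coeff j *
          (2 * (d : ℝ)) ^ j * srwI d c.length j 0)
      + 2 * ((c.map (nbwBulkBound d)).prod * (√(2 * (d : ℝ) - 1) / d)) * srwI d c.length 0 0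
      ≤ ((R : ℚ) : ℝ) := by
  simp only [rigSingleCheck, Bool.and_eq_true, decide_eq_true_eq] at h
  obtain ⟨⟨hlen, hlo0⟩, hle⟩ := h
  have hpoly : polyOfList (0 :: smulL (1 / (2 * (d : ℚ))) (prodL (c.map (nbwL d)))) =
      (c.map (nbwPoly d)).prod * C (1 / (2 * (d : ℝ))) * X := by
    rw [polyOfList_cons_zero, polyOfList_smulL, polyOfList_prodL_nbwL]; push_cast; ring
  have hmain := polySum_le_sumUp henc (0 :: smulL (1 / (2 * (d : ℚ))) (prodL (c.map (nbwL d))))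
    (by simpa [smulL] using hlen)
  rw [hpoly] at hmain
  have hI0 : 0 ≤ srwI d c.length 0 0 :=
    le_trans (by exact_mod_cast hlo0) (henc 0 (Nat.zero_le _)).1
  have hIhi : srwI d c.length 0 0 ≤ ((hi c.length 0 : ℚ) : ℝ) := (henc 0 (Nat.zero_le _)).2
  have hB := prod_nbwBulkBound_le_bulkProdQ hs c
  have hB0 := prod_nbwBulkBound_nonneg d c
  have hdpos : (0 : ℝ) < d := by exact_mod_cast hd
  have hsq : √(2 * (d : ℝ) - 1) / d ≤ (s : ℝ) / d := div_le_div_of_nonneg_right hs hdpos.le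
  have hsq0 : 0 ≤ √(2 * (d : ℝ) - 1) / d := div_nonneg (Real.sqrt_nonneg _) hdpos.le
  have hbulk : (c.map (nbwBulkBound d)).prod * (√(2 * (d : ℝ) - 1) / d) * srwI d c.length 0 0
      ≤ ((bulkProdQ s c : ℚ) : ℝ) * ((s : ℝ) / d) * ((hi c.length 0 : ℚ) : ℝ) :=
    mul_le_mul (mul_le_mul hB hsq hsq0 (hB0.trans hB)) hIhi hI0
      (mul_nonneg (hB0.trans hB) (hsq0.trans hsq))
  have hle' : ((rigSingleUp d lo hi s c : ℚ) : ℝ) ≤ ((R : ℚ) : ℝ) := by exact_mod_cast hle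
  have hR : ((rigSingleUp d lo hi s c : ℚ) : ℝ) = ((sumUp lo hi c.length (2 * (d : ℚ))
      (0 :: smulL (1 / (2 * (d : ℚ))) (prodL (c.map (nbwL d)))) 0 : ℚ) : ℝ)
      + 2 * (((bulkProdQ s c : ℚ) : ℝ) * ((s : ℝ) / d)) * ((hi c.length 0 : ℚ) : ℝ) := by
    simp only [rigSingleUp]; push_cast; ring
  nlinarith [hmain, hbulk, hle', hR]

/-- Soundness of `oddMulCheck`: the odd-multiplier closed form `oddForm d (polyOfList g) H c` is `≤ R`. [folklore] -/
private theorem oddForm_le_of_check {d L : ℕ} {lo hi : ℕ → ℕ → ℚ} {c : List ℕ}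
    (henc : ∀ j ≤ L, ((lo c.length j : ℚ) : ℝ) ≤ srwI d c.length j 0 ∧
      srwI d c.length j 0 ≤ ((hi c.length j : ℚ) : ℝ))
    {s : ℚ} (hs : √(2 * (d : ℝ) - 1) ≤ (s : ℝ)) (g : List ℚ) {H R : ℚ}
    (h : oddMulCheck d L lo hi s g H R c = true) :
    oddForm d (polyOfList g) ((H : ℚ) : ℝ) c ≤ ((R : ℚ) : ℝ) := by
  simp only [oddMulCheck, Bool.and_eq_true, decide_eq_true_eq] at h
  obtain ⟨⟨⟨hlen, hlo0⟩, hH⟩, hle⟩ := h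
  have hpoly : polyOfList (mulL (prodL (c.map (nbwL d))) g) = (c.map (nbwPoly d)).prod * polyOfList g := by
    rw [polyOfList_mulL, polyOfList_prodL_nbwL]
  have hmain := polySum_le_sumUp henc (mulL (prodL (c.map (nbwL d))) g) hlen
  rw [hpoly] at hmain
  have hI0 : 0 ≤ srwI d c.length 0 0 :=
    le_trans (by exact_mod_cast hlo0) (henc 0 (Nat.zero_le _)).1
  have hIhi : srwI d c.length 0 0 ≤ ((hi c.length 0 : ℚ) : ℝ) := (henc 0 (Nat.zero_le _)).2
  have hB := prod_nbwBulkBound_le_bulkProdQ hs c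
  have hB0 := prod_nbwBulkBound_nonneg d c
  have hH' : (0 : ℝ) ≤ 1 + ((H : ℚ) : ℝ) := by exact_mod_cast hH
  have hbulk : (1 + ((H : ℚ) : ℝ)) * (c.map (nbwBulkBound d)).prod * srwI d c.length 0 0
      ≤ (1 + ((H : ℚ) : ℝ)) * ((bulkProdQ s c : ℚ) : ℝ) * ((hi c.length 0 : ℚ) : ℝ) :=
    mul_le_mul (mul_le_mul_of_nonneg_left hB hH') hIhi hI0 (mul_nonneg hH' (hB0.trans hB))
  have hle' : ((oddMulUp d lo hi s g H c : ℚ) : ℝ) ≤ ((R : ℚ) : ℝ) := by exact_mod_cast hle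
  have hR : ((oddMulUp d lo hi s g H c : ℚ) : ℝ) = ((sumUp lo hi c.length (2 * (d : ℚ))
      (mulL (prodL (c.map (nbwL d))) g) 0 : ℚ) : ℝ)
      + (1 + ((H : ℚ) : ℝ)) * ((bulkProdQ s c : ℚ) : ℝ) * ((hi c.length 0 : ℚ) : ℝ) := by
    simp only [oddMulUp]; push_cast; ring
  unfold oddForm
  linarith

/-! ### The enumeration and the sorted representatives -/

/-- `compsL n M` enumerates exactly the lists of `n` positive naturals with sum `M`. [folklore] -/
private theorem mem_compsL_iff : ∀ {n M : ℕ} {c : List ℕ},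
    c ∈ compsL n M ↔ c.length = n ∧ c.sum = M ∧ ∀ m ∈ c, 1 ≤ m
  | 0, M, c => by
      unfold compsL
      split_ifs with hM
      · simp only [List.mem_singleton]
        constructor
        · rintro rfl; simp [hM]
        · rintro ⟨hlen, -, -⟩; exact List.eq_nil_of_length_eq_zero hlen
      · simp only [List.not_mem_nil, false_iff]
        rintro ⟨hlen, hsum, -⟩
        obtain rfl := List.eq_nil_of_length_eq_zero hlen
        exact hM (by simpa using hsum.symm)
  | n + 1, M, c => by
      unfold compsL
      simp only [List.mem_flatMap, List.mem_map, List.mem_range'_1]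
      constructor
      · rintro ⟨m, ⟨hm1, hmM⟩, c', hc', rfl⟩
        obtain ⟨hlen, hsum, hpos⟩ := mem_compsL_iff.1 hc'
        refine ⟨by simp [hlen], by simp only [List.sum_cons, hsum]; omega, fun x hx => ?_⟩
        rcases List.mem_cons.1 hx with rfl | hx
        · exact hm1
        · exact hpos x hx
      · rintro ⟨hlen, hsum, hpos⟩
        match c, hlen, hsum, hpos with
        | m :: c', hlen, hsum, hpos =>
          have hm1 := hpos m (by simp)
          simp only [List.length_cons, Nat.add_right_cancel_iff] at hlen
          simp only [List.sum_cons] at hsum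
          exact ⟨m, ⟨hm1, by omega⟩, c', mem_compsL_iff.2 ⟨hlen, by omega,
            fun x hx => hpos x (List.mem_cons_of_mem m hx)⟩, rfl⟩

/-- If `allSorted n M chk` holds then `chk` holds at the sorted representative of every admissible composition. [folklore] -/
private theorem check_of_allSorted {n M : ℕ} {chk : List ℕ → Bool} (h : allSorted n M chk = true)
    {c : List ℕ} (hlen : c.length = n) (hsum : c.sum = M) (hpos : ∀ m ∈ c, 1 ≤ m) :
    chk (c.insertionSort (· ≤ ·)) = true := by
  have hperm := List.perm_insertionSort (· ≤ ·) c
  have hmem : c.insertionSort (· ≤ ·) ∈ compsL n M :=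
    mem_compsL_iff.2 ⟨hperm.length_eq.trans hlen, hperm.sum_eq.trans hsum,
      fun m hm => hpos m (hperm.mem_iff.1 hm)⟩
  have hsorted : List.Pairwise (· ≤ ·) (c.insertionSort (· ≤ ·)) := List.pairwise_insertionSort _ _
  have := List.all_eq_true.1 h _ hmem
  simpa [hsorted] using this

/-! ### The certificate theorem -/

/-- **Soundness of the certificate.**  At dimension `d ≥ 9` and even closing length `CS`, let
`lo n l ≤ I_{n,l}(0) ≤ hi n l` (`n ≤ 4`, `l ≤ L`) be two-sided rational enclosures of the SRW integrals
[NoBLE] (5.1), `s ≥ √(2d-1)` rational, and let `g`, `H` be an odd multiplier and its bulk constant for which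
the odd-multiplier closed form `oddForm d (polyOfList g) H c` is a valid remainder-kernel constant of every
odd composition (`NbwOddMultiplierBound.isRemKernelConst_oddMul`).  If the Boolean checks hold — cell 5
(`g5`, kernel `e₁`, `rigSingleCheck`), cell 8 and the closed polygons (`rigCheck`, even order `CS + 2`),
the open polygons (`oddMulCheck`, odd order `CS + 1`), each over the sorted admissible compositions — then
`R` is a valid table of remainder constants: `Rem_c(p;x) ≤ Γ̄₂(p)^{n_r} · R r` for every read `r`, every
admissible composition `c`, every subcritical `p` and every endpoint `x` of the read.
[cite: FitznerVanDerHofstad2016NoBLE, §5.3.2 (first display) p. 1097; (5.25)–(5.27) p. 1097] -/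
theorem remValid_of_checks {d CS L : ℕ} (hd : 9 ≤ d) (hCS : Even CS) {lo hi : ℕ → ℕ → ℚ}
    (htab : ∀ n ≤ 4, ∀ l ≤ L, ((lo n l : ℚ) : ℝ) ≤ srwI d n l 0 ∧ srwI d n l 0 ≤ ((hi n l : ℚ) : ℝ))
    {s : ℚ} (hs : √(2 * (d : ℝ) - 1) ≤ (s : ℝ)) {g : List ℚ} {gR : ℝ[X]} (hg : polyOfList g = gR)
    {H : ℚ} {Hr : ℝ} (hH : ((H : ℚ) : ℝ) = Hr)
    (hodd : ∀ c : List ℕ, 2 * c.length + 1 ≤ d → Odd c.sum → IsRemKernelConst d c Set.univ (oddForm d gR Hr c))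
    {R : RemRead → ℚ}
    (h5 : allSorted 1 (CS + 1) (rigSingleCheck d L lo hi s (R .g5)) = true)
    (h8 : allSorted 1 (CS + 2) (rigCheck d L lo hi s (R .g8)) = true)
    (hcl : ∀ j : Fin 4, allSorted ((j : ℕ) + 1) (CS + 2) (rigCheck d L lo hi s (R (.cl j))) = true)
    (hop : ∀ j : Fin 4, allSorted ((j : ℕ) + 1) (CS + 1) (oddMulCheck d L lo hi s g H (R (.op j))) = true) :
    RemValid d CS fun r => ((R r : ℚ) : ℝ) := by
  intro r c hc
  obtain ⟨hlen, hsum, hpos⟩ := hc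
  have h4 := r.glines_le_four
  have hn : 2 * c.length + 1 ≤ d := by omega
  have hd2 : 2 ≤ d := by omega
  have hodd1 : Odd (CS + 1) := hCS.add_one
  have heven2 : Even (CS + 2) := hCS.add (by decide)
  -- the sorted representative and the symmetric data of `c`
  set c' := c.insertionSort (· ≤ ·) with hc'
  have hperm : c'.Perm c := List.perm_insertionSort (· ≤ ·) c
  have hlen' : c'.length = c.length := hperm.length_eq
  have hP : (c'.map (nbwPoly d)).prod = (c.map (nbwPoly d)).prod := (hperm.map _).prod_eq
  have hB : (c'.map (nbwBulkBound d)).prod = (c.map (nbwBulkBound d)).prod := (hperm.map _).prod_eq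
  have henc' : ∀ j ≤ L, ((lo c'.length j : ℚ) : ℝ) ≤ srwI d c'.length j 0 ∧
      srwI d c'.length j 0 ≤ ((hi c'.length j : ℚ) : ℝ) := by
    rw [hlen']; exact htab c.length (by omega)
  rcases r with _ | _ | j | j <;> simp only [RemRead.glines, RemRead.order] at hlen hsum <;>
    simp only [RemRead.pts]
  · -- cell 5: kernel e₁, odd order CS + 1
    have hK := isRemKernelConst_rig_single c hn hd2 (hsum ▸ hodd1)
    have hE := rigSingle_le_of_check henc' hs (by omega) (check_of_allSorted h5 hlen hsum hpos)
    rw [hlen', hP, hB] at hE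
    exact hK.of_le hE
  · -- cell 8: x-uniform, even order CS + 2
    have hK := isRemKernelConst_rig c hn hd2 (hsum ▸ heven2)
    have hE := rig_le_of_check henc' hs (check_of_allSorted h8 hlen hsum hpos)
    rw [hlen', hP, hB] at hE
    exact (hK.of_le hE).mono (Set.subset_univ _)
  · -- closed polygons: x-uniform, even order CS + 2
    have hK := isRemKernelConst_rig c hn hd2 (hsum ▸ heven2)
    have hE := rig_le_of_check henc' hs (check_of_allSorted (hcl j) hlen hsum hpos)
    rw [hlen', hP, hB] at hE
    exact (hK.of_le hE).mono (Set.subset_univ _)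
  · -- open polygons: odd multiplier, odd order CS + 1
    have hK := hodd c hn (hsum ▸ hodd1)
    have hE := oddForm_le_of_check henc' hs g (check_of_allSorted (hop j) hlen hsum hpos)
    rw [hg, hH] at hE
    unfold oddForm at hK hE
    rw [hlen', hP, hB] at hE
    exact (hK.of_le hE).mono (Set.subset_univ _)

end RemCert

end Literature.Probability.FitznerVanDerHofstad2017
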